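import Mathlib.Probability.ProductMeasure
import Mathlib.Probability.Distributions.Bernoulli
import Mathlib.Algebra.Group.Int.Even
import Literature.Probability.LatticeModels.CellGridSaddlePercolation
import Literature.Probability.Percolation.Percolation
import HarnessLib

/-!
# The corner-fugacity plane `M(t, b)` on the semi-infinite cell strip

Topic `Literature/Probability/LatticeModels` (definition item `defn-cornerFugacityStrip`, for route
`CardyCornerFugacity` of `CardyFormulaZ2`: items IKWallLawTeleport, CornerIrrelevanceWall,
FreezeToWiredDiagonal, TallDiagonalRectCardy; card `corner-fugacity-plane`). Built on the cell-grid
configuration space `CellConfig = (Site 2 → Bool) × (Site 2 → Bool)` (colouring, coins), the black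
graph `blackGraph` and the connection events `cellConnIn` of `CellGridSaddlePercolation.lean`
(definition item `defn-CellGridSaddlePercolation`, route `CardyIKTransport`), so that the strip
model and the finite-volume / full-plane corner-fugacity measures live on the same space and use
the same saddle rule.

## The model (card `corner-fugacity-plane`; Blöte–Nienhuis 1989)

Fix a width `L : ℕ`, a corner fugacity `t ≥ 0` and a saddle bias `b ∈ [0, 1]`. The strip is the
set of cells `{0, …, L-1} × ℕ ⊆ ℤ²` (`stripCells L`), flanked by the two **walls**, the columns
`{-1} × ℕ` (`leftWall`) and `{L} × ℕ` (`rightWall L`), whose cells are *black*; every other cell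
of the plane is *white* (so that black paths never leave the closed strip `closedStrip L`).
The law `cornerFugacityStrip t b L : Measure CellConfig` is the **explicit push-forward of a
countable product of independent bits** (`stripBitMeasure t b` on `StripBit → Bool`):

* `A_y ~ Ber(1/2)` for every row `y : ℕ` (`StripBit.row y`),
* `a_x ~ Ber(1/2)` for every column line `x : ℕ` (`StripBit.line x`; only `x < L - 1` matter),
* `ξ_{x,y} ~ Ber(t/(1+t))` for `x y : ℕ` (`StripBit.flip x y`; flip probability `flipProb t`),
* coins `c_w ~ Ber(b)` for every grid vertex `w : Site 2` (`StripBit.coin w`),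

under the maps (`lineChain`, `stripSpin`)

  `η_x(y) := a_x ⊕ ξ_{x,0} ⊕ ⋯ ⊕ ξ_{x,y-1}`,  `σ(x,y) := A_y ⊕ η_0(y) ⊕ ⋯ ⊕ η_{x-1}(y)`,

i.e. `η_x(y) = σ(x,y) ⊕ σ(x+1,y)` is the horizontal disagreement indicator between columns `x` and
`x+1` in row `y`, and `ξ_{x,y} = η_x(y) ⊕ η_x(y+1)` is the **plaquette parity** at the grid vertex
`(x,y)`: `ξ_{x,y} = 1` iff an odd number of the four cells `(x,y), (x+1,y), (x,y+1), (x+1,y+1)` is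
black (`stripSpin_plaquette`). Consequently, for every height `N`, the restriction of `σ` to the box
`{0..L-1} × {0..N}` has probability `t ^ #{odd plaquettes inside the box} / Z`,
`Z = 2^(N+L) (1+t)^(N (L-1))` — the **free-boundary Gibbs measure of the 4-spin plaquette weight
`∏_plaquettes t^[odd]`**, consistently in `N` (the partition function factorises over the `L-1`
independent column-line chains, each a two-state Markov chain flipping with probability `t/(1+t)`).
This identification is PROVED below (`cornerFugacityStrip_real_boxCylinder`: the XOR change of
variables is a bijection between box patterns and the finitely many bits they read,
`setOf_stripSpin_eq_eq_pi`, and the product measure evaluates one-point cylinders,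
`Measure.infinitePi_pi`), together with the reflection symmetry `x ↔ L-1-x` of the colouring law
on boxes (`cornerFugacityStrip_real_boxCylinder_reflect`) and the special values `t = 1` (uniform:
i.i.d. fair cells, `cornerFugacityStrip_one_real_boxCylinder`) and `t = 0` (only patterns without
odd plaquettes, each with probability `2^-(N+L)`, `cornerFugacityStrip_zero_real_boxCylinder`).

**Connectivity** is that of `CellGridSaddlePercolation`: black cells are joined when edge-adjacent
(wall cells included) and, through a grid vertex whose four cells form a checkerboard, the NE–SW
black pair is joined iff the coin there is `true`, the NW–SE pair iff it is `false`
(`blackGraph`; the coin-selected diagonal is kept at non-checkerboard vertices too, where it does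
not change connectivity, loc. cit.). No checkerboard occurs at a wall vertex (both wall cells are
black), nor below the base or outside the walls (white).

## Events and the base state

* `wallEvent L I` (`I : Set ℕ`): some black base cell `(x, 0)`, `x ∈ I`, `x < L`, is joined by a
  black path inside the closed strip to a wall cell.
* `baseState L ω : Fin (L+2) → Fin (L+2) → Bool`: the connection matrix, inside the closed strip, of
  the `L + 2` **marks** `stripMark L i = (i - 1, 0)`: the foot `(-1, 0)` of the left wall, the base
  cells `(0,0), …, (L-1,0)`, the foot `(L, 0)` of the right wall. Its diagonal records which base
  cells are black; since each wall is a connected black set under the strip laws, "joined to the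
  foot" is "joined to the wall" (`stripConn_leftWall_iff_foot`, `stripConn_rightWall_iff_foot`), so the matrix
  is exactly the partition of `{black base cells} ∪ {left wall, right wall}` induced by black paths
  inside the strip — the object whose LAW item IKWallLawTeleport equates — and `wallEvent` is a
  function of it (`mem_wallEvent_iff_baseState`).

## Special members

* `t = 0` (**XOR / frozen point**): `flipProb 0 = 0`, all `ξ` vanish a.s. (`ae_flip_eq_false_zero`),
  the chains are constant, `η_x ≡ a_x`, and `σ(x,y) = A_y ⊕ a_0 ⊕ ⋯ ⊕ a_{x-1}`
  (`stripSpin_succ_of_flip_eq_false`): every grid vertex inside the strip is a checkerboard or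
  monochromatic-pair vertex and black clusters propagate diagonally — bond percolation at `1/2` on
  the 45°-rotated renewal lattice (route item FreezeToWiredDiagonal; not developed here).
* `t = 1`: `flipProb 1 = half`, all colour bits are fair and the strip cells are i.i.d. fair
  (Gibbs weight `≡ 1`, `cornerFugacityStrip_one_real_boxCylinder`). With `b = 1` all coins are
  `true` a.s. (`ae_coin_eq_true_one`) and the black graph
  is site percolation on the NE–SW triangulation `cellGraph (fun _ => true) ≃g triGraph`
  (`cellGraphTrueIso`).
* `herringboneTriStrip L` (D1'): i.i.d. fair cells on the same strip with the same walls, and the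
  **deterministic herringbone coins** `herringboneCoin w = [w₁ even]` (NE–SW diagonals in even face
  rows, NW–SE in odd ones): site percolation on the triangular lattice drawn on the cell grid with
  alternately sheared rows (Morin-Duchesne–Klümper–Pearce 2023, §2.2), `herringboneIso :
  cellGraph herringboneCoin ≃g cellGraph (fun _ => true)`.

## What is deliberately NOT here

* No transfer matrices, no Izergin–Korepin weights (`DiluteA22Weights.lean` has the IK line
  `t = cornerFugacity u`, `b = saddleBias u`), no statement of IKWallLawTeleport /
  CornerIrrelevanceWall (route items).
* The parameter `t` is real; for `t < 0` the flip probability is clamped to `[0,1]` by `Set.projIcc`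
  (junk values, as for `thetaReal`).
* The Gibbs identification, the reflection symmetry and the `t = 1` independence are proved on
  box cylinders `{σ|box = s}` (boxes `{0..L-1} × {0..N}` of every height, which determine the law
  of the strip colouring); the corresponding identities of measures on `CellConfig` (π-system
  extension) are not spelled out. No named facts are introduced.

## References

* H. W. J. Blöte, B. Nienhuis, Critical behaviour and conformal anomaly of the O(n) model on the
  square lattice, *J. Phys. A* 22 (1989) 1415 [BloteNienhuis1989] (corner weights of the dilute
  loop model on the square lattice).
* A. Morin-Duchesne, A. Klümper, P. A. Pearce, Critical site percolation on the triangular lattice: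
  from integrability to conformal partition functions, *J. Stat. Mech.* (2023) 043103,
  arXiv:2211.12379, §2.2 (herringbone / sheared-row embedding, fixed boundary columns)
  [MorinDuchesneKlumperPearce2023].
* A. Garbali, B. Nienhuis, The dilute Temperley–Lieb O(n = 1) loop model on a semi infinite strip,
  arXiv:1411.7020, §2–3 [GarbaliNienhuis2017].
* G. Grimmett, *Percolation*, 2nd ed. (1999), §1.3 (product measures, cylinder events), §1.6.

## Mathlib / tree anchors

Mathlib: `MeasureTheory.Measure.infinitePi` (+ `infinitePi_pi`, `measurePreserving_eval_infinitePi`),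
`ProbabilityTheory.bernoulliMeasure` (`Ber(x, y, p)`), `Set.projIcc`, `Measure.map`,
`measurable_to_bool`, `measurable_of_countable`. Tree: `CellConfig`, `cellGraph`, `blackGraph`,
`cellConnIn`, `measurableSet_cellConnIn`, `cellGraphTrueIso` (`CellGridSaddlePercolation`), `Site`,
`zdGraph` (`LatticeGraph`), `siteConnIn`, `half` (`Percolation`), `PathIn`,
`mem_siteConnIn_iff_pathIn` (`SitePaths`).
-/

namespace Literature.Probability.LatticeModels

open _root_.MeasureTheory _root_.ProbabilityTheory Percolation
open scoped ENNReal

noncomputable section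

/-! ### The independent bits -/

/-- Index set of the independent bits of the strip model: `row y` is the seed `A_y` of row `y`,
`line x` the seed `a_x` of the column-line chain between columns `x` and `x + 1`, `flip x y` the
flip variable `ξ_{x,y}` of that chain between rows `y` and `y + 1` (= the plaquette parity at the
grid vertex `(x, y)`), and `coin w` the saddle coin at the grid vertex `w`.
(Card `corner-fugacity-plane`, definition request D1.) [folklore] -/
inductive StripBit : Type
  | row (y : ℕ)
  | line (x : ℕ)
  | flip (x y : ℕ)
  | coin (w : Site 2)
  deriving DecidableEq

/-- `StripBit` is countable (it embeds in `ℕ ⊕ ℕ ⊕ (ℕ × ℕ) ⊕ Site 2`). [folklore] -/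
instance StripBit.instCountable : Countable StripBit := by
  classical
  refine Function.Injective.countable
    (f := fun i : StripBit => (match i with
      | .row y => Sum.inl y
      | .line x => Sum.inr (Sum.inl x)
      | .flip x y => Sum.inr (Sum.inr (Sum.inl (x, y)))
      | .coin w => Sum.inr (Sum.inr (Sum.inr w)) : ℕ ⊕ ℕ ⊕ (ℕ × ℕ) ⊕ Site 2)) ?_
  rintro (y | x | ⟨x, y⟩ | w) (y' | x' | ⟨x', y'⟩ | w') h <;> simp_all

/-- The flip probability `t / (1 + t) ∈ [0, 1)` of a column-line chain with corner fugacity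
`t ≥ 0` (a free two-state chain with transition weights `1` (stay) and `t` (flip)); clamped to
`[0, 1]` by `Set.projIcc` for `t < 0` (junk). (Card `corner-fugacity-plane`: column chains flip
with probability `t/(1+t)`.) [folklore] -/
def flipProb (t : ℝ) : unitInterval := Set.projIcc 0 1 zero_le_one (t / (1 + t))

/-- For `t ≥ 0`, `flipProb t = t / (1 + t)`. [folklore] -/
theorem coe_flipProb {t : ℝ} (ht : 0 ≤ t) : (flipProb t : ℝ) = t / (1 + t) := by
  have h1 : 0 < 1 + t := by linarith
  rw [flipProb, Set.coe_projIcc, max_eq_right, min_eq_right]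
  · exact (div_le_one h1).2 (by linarith)
  · exact le_min zero_le_one (div_nonneg ht h1.le)

/-- `flipProb 0 = 0`: at zero corner fugacity the chains never flip. [folklore] -/
@[simp] theorem flipProb_zero : flipProb 0 = 0 := by
  ext; rw [coe_flipProb le_rfl]; simp

/-- `flipProb 1 = 1/2`: at `t = 1` the flips are fair. [folklore] -/
@[simp] theorem flipProb_one : flipProb 1 = half := by
  ext; rw [coe_flipProb zero_le_one, coe_half]; norm_num

/-- The one-bit laws: rows and lines fair, flips `Ber(t/(1+t))`, coins `Ber(b)` (`true` with the
stated probability). (Card `corner-fugacity-plane`, D1.) [folklore] -/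
def stripBitLaw (t : ℝ) (b : unitInterval) : StripBit → Measure Bool
  | .row _ => Ber(true, false, half)
  | .line _ => Ber(true, false, half)
  | .flip _ _ => Ber(true, false, flipProb t)
  | .coin _ => Ber(true, false, b)

/-- Each one-bit law is a probability measure. [folklore] -/
instance instIsProbabilityMeasureStripBitLaw (t : ℝ) (b : unitInterval) (i : StripBit) :
    IsProbabilityMeasure (stripBitLaw t b i) := by
  cases i <;> simp only [stripBitLaw] <;> infer_instance

/-- The law of the independent bits: the product over `StripBit` of the one-bit laws
(Mathlib's `Measure.infinitePi`). (Card `corner-fugacity-plane`, D1; Grimmett 1999, §1.3.) [folklore] -/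
def stripBitMeasure (t : ℝ) (b : unitInterval) : Measure (StripBit → Bool) :=
  Measure.infinitePi (stripBitLaw t b)

/-- `stripBitMeasure t b` is a probability measure. [folklore] -/
instance instIsProbabilityMeasureStripBitMeasure (t : ℝ) (b : unitInterval) :
    IsProbabilityMeasure (stripBitMeasure t b) := by
  unfold stripBitMeasure; infer_instance

/-- The marginal of one bit. [folklore] -/
theorem stripBitMeasure_map_eval (t : ℝ) (b : unitInterval) (i : StripBit) :
    (stripBitMeasure t b).map (fun β => β i) = stripBitLaw t b i :=
  Measure.infinitePi_map_eval _ i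

/-! ### The colouring: column-line chains and spins -/

/-- The column-line chain `η_x(y) = a_x ⊕ ξ_{x,0} ⊕ ⋯ ⊕ ξ_{x,y-1}` (horizontal disagreement
indicator between the cells `(x, y)` and `(x+1, y)`), defined by `η_x(0) = a_x`,
`η_x(y+1) = η_x(y) ⊕ ξ_{x,y}`. (Card `corner-fugacity-plane`, D1.) [folklore] -/
def lineChain (β : StripBit → Bool) (x : ℕ) : ℕ → Bool
  | 0 => β (.line x)
  | y + 1 => (lineChain β x y ^^ β (.flip x y))

/-- The spin (colour, `true` = black) of the strip cell `(x, y)`: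
`σ(x,y) = A_y ⊕ η_0(y) ⊕ ⋯ ⊕ η_{x-1}(y)`, defined by `σ(0,y) = A_y`,
`σ(x+1,y) = σ(x,y) ⊕ η_x(y)`. (Card `corner-fugacity-plane`, D1.) [folklore] -/
def stripSpin (β : StripBit → Bool) : ℕ → ℕ → Bool
  | 0, y => β (.row y)
  | x + 1, y => (stripSpin β x y ^^ lineChain β x y)

/-- `η_x(0) = a_x`. [folklore] -/
@[simp] theorem lineChain_zero (β : StripBit → Bool) (x : ℕ) : lineChain β x 0 = β (.line x) := rfl

/-- `η_x(y+1) = η_x(y) ⊕ ξ_{x,y}`. [folklore] -/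
@[simp] theorem lineChain_succ (β : StripBit → Bool) (x y : ℕ) :
    lineChain β x (y + 1) = (lineChain β x y ^^ β (.flip x y)) := rfl

/-- `σ(0,y) = A_y`. [folklore] -/
@[simp] theorem stripSpin_zero (β : StripBit → Bool) (y : ℕ) : stripSpin β 0 y = β (.row y) := rfl

/-- `σ(x+1,y) = σ(x,y) ⊕ η_x(y)`. [folklore] -/
@[simp] theorem stripSpin_succ (β : StripBit → Bool) (x y : ℕ) :
    stripSpin β (x + 1) y = (stripSpin β x y ^^ lineChain β x y) := rfl

/-- `η_x(y) = σ(x,y) ⊕ σ(x+1,y)`: the chain is the horizontal disagreement indicator. [folklore] -/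
theorem lineChain_eq_xor_stripSpin (β : StripBit → Bool) (x y : ℕ) :
    lineChain β x y = (stripSpin β x y ^^ stripSpin β (x + 1) y) := by
  rw [stripSpin_succ]; cases stripSpin β x y <;> cases lineChain β x y <;> rfl

/-- **Plaquette parity.** The XOR of the four spins around the grid vertex `(x, y)` (cells
`(x,y), (x+1,y), (x,y+1), (x+1,y+1)`) is the flip bit `ξ_{x,y}`: the number of black cells around
the vertex is odd iff `ξ_{x,y} = 1`. This is why the law of `σ` is the plaquette Gibbs measure
with weight `t` per odd vertex. (Card `corner-fugacity-plane`: "4-spin plaquette field".) [folklore] -/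
theorem stripSpin_plaquette (β : StripBit → Bool) (x y : ℕ) :
    ((stripSpin β x y ^^ stripSpin β (x + 1) y) ^^ (stripSpin β x (y + 1) ^^ stripSpin β (x + 1) (y + 1)))
      = β (.flip x y) := by
  simp only [stripSpin_succ, lineChain_succ]
  cases stripSpin β x y <;> cases stripSpin β x (y + 1) <;> cases lineChain β x y <;>
    cases β (.flip x y) <;> rfl

/-- **Frozen point, pointwise.** If all flip bits of the chain `x` vanish then `η_x ≡ a_x`.
[folklore] -/
theorem lineChain_of_flip_eq_false {β : StripBit → Bool} {x : ℕ} (h : ∀ y, β (.flip x y) = false)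
    (y : ℕ) : lineChain β x y = β (.line x) := by
  induction y with
  | zero => rfl
  | succ y ih => rw [lineChain_succ, ih, h, Bool.xor_false]

/-- **Frozen point, pointwise.** If all flip bits vanish (which holds a.s. at `t = 0`,
`ae_flip_eq_false_zero`) then `σ(x+1,y) = σ(x,y) ⊕ a_x`, i.e.
`σ(x,y) = A_y ⊕ a_0 ⊕ ⋯ ⊕ a_{x-1}`: the XOR colourings of route item FreezeToWiredDiagonal.
[folklore] -/
theorem stripSpin_succ_of_flip_eq_false {β : StripBit → Bool} (h : ∀ x y, β (.flip x y) = false)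
    (x y : ℕ) : stripSpin β (x + 1) y = (stripSpin β x y ^^ β (.line x)) := by
  rw [stripSpin_succ, lineChain_of_flip_eq_false (h x)]

/-! ### The strip, its walls, and the configuration map -/

/-- The cells of the (open) strip of width `L`: `{0, …, L-1} × ℕ`. [folklore] -/
def stripCells (L : ℕ) : Set (Site 2) := {z | 0 ≤ z 0 ∧ z 0 < L ∧ 0 ≤ z 1}

/-- The left wall `{-1} × ℕ`. [folklore] -/
def leftWall : Set (Site 2) := {z | z 0 = -1 ∧ 0 ≤ z 1}

/-- The right wall `{L} × ℕ` of the strip of width `L`. [folklore] -/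
def rightWall (L : ℕ) : Set (Site 2) := {z | z 0 = L ∧ 0 ≤ z 1}

/-- The closed strip `{-1, …, L} × ℕ`: the strip together with its two walls. [folklore] -/
def closedStrip (L : ℕ) : Set (Site 2) := {z | -1 ≤ z 0 ∧ z 0 ≤ L ∧ 0 ≤ z 1}

/-- The base cell `(x, 0)` of column `x`. [folklore] -/
def baseCell (x : ℕ) : Site 2 := ![(x : ℤ), 0]

/-- First coordinate of the base cell. [folklore] -/
@[simp] theorem baseCell_zero (x : ℕ) : baseCell x 0 = x := rfl
/-- Second coordinate of the base cell. [folklore] -/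
@[simp] theorem baseCell_one (x : ℕ) : baseCell x 1 = 0 := rfl

/-- Membership in the strip, unfolded. [folklore] -/
theorem mem_stripCells_iff {L : ℕ} {z : Site 2} :
    z ∈ stripCells L ↔ 0 ≤ z 0 ∧ z 0 < L ∧ 0 ≤ z 1 := Iff.rfl
/-- Membership in the left wall, unfolded. [folklore] -/
theorem mem_leftWall_iff {z : Site 2} : z ∈ leftWall ↔ z 0 = -1 ∧ 0 ≤ z 1 := Iff.rfl
/-- Membership in the right wall, unfolded. [folklore] -/
theorem mem_rightWall_iff {L : ℕ} {z : Site 2} : z ∈ rightWall L ↔ z 0 = L ∧ 0 ≤ z 1 := Iff.rfl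
/-- Membership in the closed strip, unfolded. [folklore] -/
theorem mem_closedStrip_iff {L : ℕ} {z : Site 2} :
    z ∈ closedStrip L ↔ -1 ≤ z 0 ∧ z 0 ≤ L ∧ 0 ≤ z 1 := Iff.rfl

/-- The strip lies in the closed strip. [folklore] -/
theorem stripCells_subset_closedStrip (L : ℕ) : stripCells L ⊆ closedStrip L := by
  intro z hz; rw [mem_stripCells_iff] at hz; rw [mem_closedStrip_iff]; omega
/-- The left wall lies in the closed strip. [folklore] -/
theorem leftWall_subset_closedStrip (L : ℕ) : leftWall ⊆ closedStrip L := by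
  intro z hz; rw [mem_leftWall_iff] at hz; rw [mem_closedStrip_iff]; omega
/-- The right wall lies in the closed strip. [folklore] -/
theorem rightWall_subset_closedStrip (L : ℕ) : rightWall L ⊆ closedStrip L := by
  intro z hz; rw [mem_rightWall_iff] at hz; rw [mem_closedStrip_iff]; omega
/-- Base cells `(x, 0)`, `x < L`, are strip cells. [folklore] -/
theorem baseCell_mem_stripCells {L x : ℕ} (hx : x < L) : baseCell x ∈ stripCells L := by
  rw [mem_stripCells_iff, baseCell_zero, baseCell_one]; omega

/-- The colouring of the plane determined by a colouring `s : ℕ → ℕ → Bool` of the strip cells: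
`s` on the strip, black on the two walls, white everywhere else. [folklore] -/
def stripColouring (L : ℕ) (s : ℕ → ℕ → Bool) (z : Site 2) : Bool :=
  if 0 ≤ z 1 then
    if 0 ≤ z 0 ∧ z 0 < L then s (z 0).toNat (z 1).toNat else decide (z 0 = -1 ∨ z 0 = L)
  else false

/-- On the strip cell `(x, y)` the colouring is `s x y`. [folklore] -/
@[simp] theorem stripColouring_natCell {L : ℕ} (s : ℕ → ℕ → Bool) {x : ℕ} (hx : x < L) (y : ℕ) :
    stripColouring L s ![(x : ℤ), y] = s x y := by
  simp [stripColouring, hx]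

/-- On strip cells the colouring is the given strip colouring. [folklore] -/
theorem stripColouring_of_mem_stripCells {L : ℕ} (s : ℕ → ℕ → Bool) {z : Site 2}
    (hz : z ∈ stripCells L) : stripColouring L s z = s (z 0).toNat (z 1).toNat := by
  rw [mem_stripCells_iff] at hz
  simp [stripColouring, hz.1, hz.2.1, hz.2.2]

/-- Wall cells are black. [folklore] -/
theorem stripColouring_of_mem_wall {L : ℕ} (s : ℕ → ℕ → Bool) {z : Site 2}
    (hz : z ∈ leftWall ∪ rightWall L) : stripColouring L s z = true := by
  rcases hz with hz | hz
  · rw [mem_leftWall_iff] at hz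
    simp [stripColouring, hz.2, hz.1]
  · rw [mem_rightWall_iff] at hz
    simp [stripColouring, hz.2, hz.1]

/-- Cells outside the closed strip are white. [folklore] -/
theorem stripColouring_of_not_mem_closedStrip {L : ℕ} (s : ℕ → ℕ → Bool) {z : Site 2}
    (hz : z ∉ closedStrip L) : stripColouring L s z = false := by
  rw [mem_closedStrip_iff] at hz
  by_cases h1 : 0 ≤ z 1
  · have h2 : ¬ (0 ≤ z 0 ∧ z 0 < L) := by omega
    have h3 : ¬ (z 0 = -1 ∨ z 0 = L) := by omega
    simp [stripColouring, h1, h2, h3]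
  · simp [stripColouring, h1]

/-- A black cell lies in the closed strip. [folklore] -/
theorem mem_closedStrip_of_stripColouring {L : ℕ} {s : ℕ → ℕ → Bool} {z : Site 2}
    (hz : stripColouring L s z = true) : z ∈ closedStrip L := by
  by_contra h; rw [stripColouring_of_not_mem_closedStrip s h] at hz; exact Bool.false_ne_true hz

/-- **The configuration map** of the strip of width `L`: the colouring `σ` of the strip cells
(`stripSpin`), black walls, white elsewhere; the coin at the grid vertex `w` is the bit `coin w`.
(Card `corner-fugacity-plane`, D1.) [folklore] -/
def stripConfig (L : ℕ) (β : StripBit → Bool) : CellConfig :=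
  (stripColouring L (stripSpin β), fun w => β (.coin w))

/-- The colouring component of the strip configuration. [folklore] -/
@[simp] theorem stripConfig_fst (L : ℕ) (β : StripBit → Bool) :
    (stripConfig L β).1 = stripColouring L (stripSpin β) := rfl
/-- The coin component of the strip configuration. [folklore] -/
@[simp] theorem stripConfig_snd (L : ℕ) (β : StripBit → Bool) (w : Site 2) :
    (stripConfig L β).2 w = β (.coin w) := rfl

/-- **The corner-fugacity plane on the semi-infinite strip.** `cornerFugacityStrip t b L` is the
law on `CellConfig` of the strip configuration of width `L` with corner fugacity `t` and saddle
bias `b`: the push-forward of the independent bits `stripBitMeasure t b` under `stripConfig L`.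
(Card `corner-fugacity-plane`, definition request D1 of route `CardyCornerFugacity`;
Blöte–Nienhuis 1989, corner weights of the square-lattice dilute loop model.) [folklore] -/
def cornerFugacityStrip (t : ℝ) (b : unitInterval) (L : ℕ) : Measure CellConfig :=
  (stripBitMeasure t b).map (stripConfig L)

/-! ### Measurability -/

section Measurability

variable {Ω' : Type*} [MeasurableSpace Ω']

/-- XOR of two measurable bits is measurable. [folklore] -/
theorem measurable_bool_xor {f g : Ω' → Bool} (hf : Measurable f) (hg : Measurable g) :
    Measurable fun ω => (f ω ^^ g ω) :=
  (measurable_of_countable fun p : Bool × Bool => (p.1 ^^ p.2)).comp (hf.prodMk hg)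

/-- Each chain value is a measurable function of the bits. [folklore] -/
theorem measurable_lineChain (x y : ℕ) : Measurable fun β : StripBit → Bool => lineChain β x y := by
  induction y with
  | zero => exact measurable_pi_apply (StripBit.line x)
  | succ y ih => exact measurable_bool_xor ih (measurable_pi_apply _)

/-- Each spin is a measurable function of the bits. [folklore] -/
theorem measurable_stripSpin (x y : ℕ) : Measurable fun β : StripBit → Bool => stripSpin β x y := by
  induction x with
  | zero => exact measurable_pi_apply (StripBit.row y)
  | succ x ih => exact measurable_bool_xor ih (measurable_lineChain x y)

/-- The colouring of a fixed cell is a measurable function of the strip colouring data, for a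
measurably parametrised family. [folklore] -/
theorem measurable_stripColouring (L : ℕ) {s : Ω' → ℕ → ℕ → Bool}
    (hs : ∀ x y, Measurable fun ω => s ω x y) (z : Site 2) :
    Measurable fun ω => stripColouring L (s ω) z := by
  unfold stripColouring
  split_ifs
  · exact hs _ _
  · exact measurable_const
  · exact measurable_const

/-- **The configuration map is measurable.** [folklore] -/
theorem measurable_stripConfig (L : ℕ) : Measurable (stripConfig L) := by
  refine Measurable.prodMk (measurable_pi_lambda _ fun z => ?_) (measurable_pi_lambda _ fun w => ?_)
  · exact measurable_stripColouring L (fun x y => measurable_stripSpin x y) z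
  · exact measurable_pi_apply (StripBit.coin w)

end Measurability

/-- `cornerFugacityStrip t b L` is a probability measure. [folklore] -/
instance instIsProbabilityMeasureCornerFugacityStrip (t : ℝ) (b : unitInterval) (L : ℕ) :
    IsProbabilityMeasure (cornerFugacityStrip t b L) :=
  Measure.isProbabilityMeasure_map (measurable_stripConfig L).aemeasurable

/-- The probability of a measurable event is the bit-measure of its preimage. [folklore] -/
theorem cornerFugacityStrip_apply (t : ℝ) (b : unitInterval) (L : ℕ) {E : Set CellConfig}
    (hE : MeasurableSet E) :
    cornerFugacityStrip t b L E = stripBitMeasure t b (stripConfig L ⁻¹' E) :=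
  Measure.map_apply (measurable_stripConfig L) hE

/-- Transfer of sure properties of strip configurations to almost-sure properties under the
strip law. [folklore] -/
theorem ae_cornerFugacityStrip_of_forall (t : ℝ) (b : unitInterval) (L : ℕ) {P : CellConfig → Prop}
    (hP : MeasurableSet {ω | P ω}) (h : ∀ β, P (stripConfig L β)) :
    ∀ᵐ ω ∂(cornerFugacityStrip t b L), P ω := by
  rw [cornerFugacityStrip, ae_map_iff (measurable_stripConfig L).aemeasurable hP]
  exact ae_of_all _ h

/-- **Walls are black, surely**: under every strip configuration the wall cells are black and the
cells outside the closed strip are white. [folklore] -/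
theorem stripConfig_wall (L : ℕ) (β : StripBit → Bool) {z : Site 2} (hz : z ∈ leftWall ∪ rightWall L) :
    (stripConfig L β).1 z = true :=
  stripColouring_of_mem_wall _ hz

/-- Cells outside the closed strip are white, surely. [folklore] -/
theorem stripConfig_outside (L : ℕ) (β : StripBit → Bool) {z : Site 2} (hz : z ∉ closedStrip L) :
    (stripConfig L β).1 z = false :=
  stripColouring_of_not_mem_closedStrip _ hz

/-- The spin of the strip cell `(x, y)`, `x < L`, under the strip configuration. [folklore] -/
theorem stripConfig_natCell (L : ℕ) (β : StripBit → Bool) {x : ℕ} (hx : x < L) (y : ℕ) :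
    (stripConfig L β).1 ![(x : ℤ), y] = stripSpin β x y :=
  stripColouring_natCell _ hx y

/-! ### The frozen point `t = 0` -/

/-- At `t = 0` each flip bit has law `dirac false`. [folklore] -/
theorem stripBitLaw_zero_flip (b : unitInterval) (x y : ℕ) :
    stripBitLaw 0 b (.flip x y) = Measure.dirac false := by
  simp [stripBitLaw]

/-- **Frozen point, almost surely.** Under `stripBitMeasure 0 b` all flip bits vanish a.s., so that
a.s. `σ(x+1,y) = σ(x,y) ⊕ a_x` (`stripSpin_succ_of_flip_eq_false`). [folklore] -/
theorem ae_flip_eq_false_zero (b : unitInterval) :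
    ∀ᵐ β ∂(stripBitMeasure 0 b), ∀ x y, β (.flip x y) = false := by
  rw [ae_all_iff]; intro x; rw [ae_all_iff]; intro y
  have hmp := measurePreserving_eval_infinitePi (stripBitLaw 0 b) (StripBit.flip x y)
  have h : ∀ᵐ c ∂(stripBitLaw 0 b (.flip x y)), c = false := by
    rw [stripBitLaw_zero_flip, ae_dirac_eq, Filter.eventually_pure]
  exact hmp.quasiMeasurePreserving.ae h

/-- At `t = 1` the flip bits are fair, like the row and line bits: all colour bits are i.i.d.
fair. [folklore] -/
theorem stripBitLaw_one_flip (b : unitInterval) (x y : ℕ) :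
    stripBitLaw 1 b (.flip x y) = Ber(true, false, half) := by
  simp [stripBitLaw]

/-- With saddle bias `b = 1` every coin has law `dirac true` (all diagonals NE–SW: the
triangulation `cellGraph (fun _ => true) ≃g triGraph`, `cellGraphTrueIso`). [folklore] -/
theorem stripBitLaw_coin_one (t : ℝ) (w : Site 2) :
    stripBitLaw t 1 (.coin w) = Measure.dirac true := by
  simp [stripBitLaw]

/-- **`b = 1`, almost surely**: all coins are `true`. [folklore] -/
theorem ae_coin_eq_true_one (t : ℝ) :
    ∀ᵐ β ∂(stripBitMeasure t 1), ∀ w, β (.coin w) = true := by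
  rw [ae_all_iff]; intro w
  have hmp := measurePreserving_eval_infinitePi (stripBitLaw t 1) (StripBit.coin w)
  have h : ∀ᵐ c ∂(stripBitLaw t 1 (.coin w)), c = true := by
    rw [stripBitLaw_coin_one, ae_dirac_eq, Filter.eventually_pure]
  exact hmp.quasiMeasurePreserving.ae h

/-! ### Connection events: walls and the base state -/

/-- The event that the cells `u, v` are joined by a path of black cells of the **closed** strip
(walls included) in the black graph (`cellConnIn` of `CellGridSaddlePercolation`). [folklore] -/
def stripConn (L : ℕ) (u v : Site 2) : Set CellConfig := cellConnIn (closedStrip L) u v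

/-- `stripConn` as a chain of black cells of the closed strip (`PathIn`). [folklore] -/
theorem mem_stripConn_iff_pathIn {L : ℕ} {u v : Site 2} {ω : CellConfig} :
    ω ∈ stripConn L u v ↔ PathIn (cellGraph ω.2) (closedStrip L ∩ ω.black) u v :=
  mem_cellConnIn_iff_pathIn

/-- `stripConn` is symmetric. [folklore] -/
theorem stripConn_comm {L : ℕ} {u v : Site 2} {ω : CellConfig} :
    ω ∈ stripConn L u v ↔ ω ∈ stripConn L v u := by
  simp only [mem_stripConn_iff_pathIn]; exact ⟨PathIn.symm, PathIn.symm⟩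

/-- `stripConn` is transitive. [folklore] -/
theorem stripConn_trans {L : ℕ} {u v w : Site 2} {ω : CellConfig} (h₁ : ω ∈ stripConn L u v)
    (h₂ : ω ∈ stripConn L v w) : ω ∈ stripConn L u w := by
  rw [mem_stripConn_iff_pathIn] at *; exact h₁.trans h₂

/-- `stripConn L u v` is measurable. [folklore] -/
theorem measurableSet_stripConn (L : ℕ) (u v : Site 2) : MeasurableSet (stripConn L u v) :=
  measurableSet_cellConnIn _ u v

/-- **The wall event** `wallEvent L I`: some base cell `(x, 0)` with `x ∈ I`, `x < L`, is black and
joined by a path of black cells of the closed strip to a wall cell. (Route `CardyCornerFugacity`,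
items CornerIrrelevanceWall / FreezeToWiredDiagonal: "base-to-wall events".) [folklore] -/
def wallEvent (L : ℕ) (I : Set ℕ) : Set CellConfig :=
  {ω | ∃ x ∈ I, x < L ∧ ∃ w ∈ leftWall ∪ rightWall L, ω ∈ stripConn L (baseCell x) w}

/-- Membership in the wall event, unfolded. [folklore] -/
theorem mem_wallEvent_iff {L : ℕ} {I : Set ℕ} {ω : CellConfig} :
    ω ∈ wallEvent L I ↔ ∃ x ∈ I, x < L ∧ ∃ w ∈ leftWall ∪ rightWall L, ω ∈ stripConn L (baseCell x) w :=
  Iff.rfl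

/-- The wall event is measurable. [folklore] -/
theorem measurableSet_wallEvent (L : ℕ) (I : Set ℕ) : MeasurableSet (wallEvent L I) := by
  have hset : wallEvent L I = ⋃ x ∈ I ∩ Set.Iio L, ⋃ w ∈ leftWall ∪ rightWall L,
      stripConn L (baseCell x) w := by
    ext ω
    simp only [mem_wallEvent_iff, Set.mem_iUnion, Set.mem_inter_iff, Set.mem_Iio, exists_prop,
      and_assoc]
  rw [hset]
  exact MeasurableSet.biUnion (Set.to_countable _) fun x _ =>
    MeasurableSet.biUnion (Set.to_countable _) fun w _ => measurableSet_stripConn L _ w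

/-- The `L + 2` **marks** of the strip of width `L`: `stripMark L i = (i - 1, 0)`, i.e. the foot
`(-1, 0)` of the left wall (`i = 0`), the base cells `(0, 0), …, (L-1, 0)` (`i = x + 1`) and the
foot `(L, 0)` of the right wall (`i = L + 1`). [folklore] -/
def stripMark (L : ℕ) (i : Fin (L + 2)) : Site 2 := ![(i : ℤ) - 1, 0]

/-- First coordinate of a mark. [folklore] -/
@[simp] theorem stripMark_apply_zero (L : ℕ) (i : Fin (L + 2)) : stripMark L i 0 = (i : ℤ) - 1 := rfl
/-- Second coordinate of a mark. [folklore] -/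
@[simp] theorem stripMark_apply_one (L : ℕ) (i : Fin (L + 2)) : stripMark L i 1 = 0 := rfl

/-- The first mark is the foot of the left wall. [folklore] -/
theorem stripMark_zero (L : ℕ) : stripMark L 0 = ![-1, 0] := by
  ext i; fin_cases i <;> simp [stripMark]

/-- The last mark is the foot of the right wall. [folklore] -/
theorem stripMark_last (L : ℕ) : stripMark L (Fin.last (L + 1)) = ![(L : ℤ), 0] := by
  ext i; fin_cases i <;> simp [stripMark]

/-- The mark `x + 1` is the base cell `(x, 0)`. [folklore] -/
theorem stripMark_succ (L : ℕ) (x : ℕ) (hx : x < L) :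
    stripMark L ⟨x + 1, by omega⟩ = baseCell x := by
  ext i; fin_cases i <;> simp [stripMark, baseCell]

/-- The first mark lies on the left wall. [folklore] -/
theorem stripMark_zero_mem_leftWall (L : ℕ) : stripMark L 0 ∈ leftWall := by
  simp [mem_leftWall_iff]

/-- The last mark lies on the right wall. [folklore] -/
theorem stripMark_last_mem_rightWall (L : ℕ) : stripMark L (Fin.last (L + 1)) ∈ rightWall L := by
  simp [mem_rightWall_iff]

open Classical in
/-- **The base state** of a configuration on the strip of width `L`: the Boolean matrix recording
which pairs of marks (left-wall foot, base cells, right-wall foot) are joined by a path of black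
cells of the closed strip. The diagonal entry of a base cell records whether it is black; under the
strip laws the walls are connected black sets, so an entry against a wall foot records connection
to that wall (`stripConn_leftWall_iff_foot`). This finite object encodes the partition of
`{black base cells} ∪ {left wall, right wall}` induced by black paths inside the strip, whose law
route item IKWallLawTeleport equates between `M(√3/2, 1/2)` and the herringbone strip.
(Route `CardyCornerFugacity`, D1.) [folklore] -/
def baseState (L : ℕ) (ω : CellConfig) (i j : Fin (L + 2)) : Bool :=
  decide (ω ∈ stripConn L (stripMark L i) (stripMark L j))

/-- An entry of the base state is `true` iff the two marks are joined inside the closed strip.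
[folklore] -/
theorem baseState_eq_true_iff {L : ℕ} {ω : CellConfig} {i j : Fin (L + 2)} :
    baseState L ω i j = true ↔ ω ∈ stripConn L (stripMark L i) (stripMark L j) := by
  simp [baseState]

/-- The base state is a symmetric matrix. [folklore] -/
theorem baseState_comm (L : ℕ) (ω : CellConfig) (i j : Fin (L + 2)) :
    baseState L ω i j = baseState L ω j i := by
  rw [Bool.eq_iff_iff, baseState_eq_true_iff, baseState_eq_true_iff, stripConn_comm]

/-- **The base state is measurable** (a finite family of connection events). [folklore] -/
theorem measurable_baseState (L : ℕ) : Measurable (baseState L) := by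
  refine measurable_pi_lambda _ fun i => measurable_pi_lambda _ fun j => measurable_to_bool ?_
  have hset : (fun ω => baseState L ω i j) ⁻¹' {true} = stripConn L (stripMark L i) (stripMark L j) := by
    ext ω; simp [baseState_eq_true_iff]
  rw [hset]; exact measurableSet_stripConn L _ _

/-- The law of the base state under the strip law with parameters `(t, b)`. [folklore] -/
def baseStateLaw (t : ℝ) (b : unitInterval) (L : ℕ) : Measure (Fin (L + 2) → Fin (L + 2) → Bool) :=
  (cornerFugacityStrip t b L).map (baseState L)

/-- The base-state law is a probability measure. [folklore] -/
instance instIsProbabilityMeasureBaseStateLaw (t : ℝ) (b : unitInterval) (L : ℕ) :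
    IsProbabilityMeasure (baseStateLaw t b L) :=
  Measure.isProbabilityMeasure_map (measurable_baseState L).aemeasurable

/-! ### Walls are connected: foot lemmas -/

section Walls

/-- Local copy of the coordinate description of adjacency in `ℤ²`. [folklore] -/
private theorem zd2_adj_coord' (x y : Site 2) :
    (zdGraph 2).Adj x y ↔
      ((y 0 = x 0 + 1 ∨ x 0 = y 0 + 1) ∧ y 1 = x 1) ∨
        ((y 1 = x 1 + 1 ∨ x 1 = y 1 + 1) ∧ y 0 = x 0) := by
  rw [zdGraph_adj_iff, Fin.exists_fin_two]
  simp only [funext_iff, Fin.forall_fin_two, Pi.add_apply, Pi.single_eq_same,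
    Pi.single_eq_of_ne (one_ne_zero : (1 : Fin 2) ≠ 0),
    Pi.single_eq_of_ne (zero_ne_one : (0 : Fin 2) ≠ 1), add_zero]
  omega

variable {L : ℕ} {ω : CellConfig}

/-- If a wall column is black, any two of its cells are joined inside the closed strip
(a vertical run of edge-adjacent black cells). [folklore] -/
private theorem pathIn_column {c : ℤ} (hc : -1 ≤ c ∧ c ≤ L)
    (hblack : ∀ z : Site 2, z 0 = c → 0 ≤ z 1 → ω.1 z = true) (n : ℕ) :
    PathIn (cellGraph ω.2) (closedStrip L ∩ ω.black) ![c, 0] ![c, (n : ℤ)] := by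
  induction n with
  | zero => exact PathIn.refl ⟨by rw [mem_closedStrip_iff]; simp; omega, by simpa using hblack _ rfl le_rfl⟩
  | succ n ih =>
    refine ih.tail (zdGraph_le_cellGraph _ ?_) ⟨?_, ?_⟩
    · rw [zd2_adj_coord']; simp
    · rw [mem_closedStrip_iff]; simp; omega
    · simpa using hblack _ rfl (by push_cast; omega)

/-- **Left foot lemma.** If the left wall is black (as under every strip configuration), a cell is
joined inside the closed strip to *some* left-wall cell iff it is joined to the foot `(-1, 0)`.
[folklore] -/
theorem stripConn_leftWall_iff_foot (hwall : ∀ z ∈ leftWall, ω.1 z = true) (u : Site 2) :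
    (∃ w ∈ leftWall, ω ∈ stripConn L u w) ↔ ω ∈ stripConn L u (stripMark L 0) := by
  constructor
  · rintro ⟨w, hw, h⟩
    rw [mem_leftWall_iff] at hw
    have hpath := pathIn_column (L := L) (ω := ω) (c := -1) (by omega)
      (fun z h0 h1 => hwall z ⟨h0, h1⟩) (w 1).toNat
    have hw' : (![-1, ((w 1).toNat : ℤ)] : Site 2) = w := by
      ext i; fin_cases i
      · simp [hw.1]
      · simp [Int.toNat_of_nonneg hw.2]
    rw [hw'] at hpath
    rw [stripMark_zero]
    exact stripConn_trans h (mem_stripConn_iff_pathIn.2 hpath.symm)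
  · intro h
    exact ⟨_, stripMark_zero_mem_leftWall L, h⟩

/-- **Right foot lemma**, likewise for the right wall and its foot `(L, 0)`. [folklore] -/
theorem stripConn_rightWall_iff_foot (hwall : ∀ z ∈ rightWall L, ω.1 z = true) (u : Site 2) :
    (∃ w ∈ rightWall L, ω ∈ stripConn L u w) ↔ ω ∈ stripConn L u (stripMark L (Fin.last (L + 1))) := by
  constructor
  · rintro ⟨w, hw, h⟩
    rw [mem_rightWall_iff] at hw
    have hpath := pathIn_column (L := L) (ω := ω) (c := L) (by omega)
      (fun z h0 h1 => hwall z ⟨h0, h1⟩) (w 1).toNat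
    have hw' : (![(L : ℤ), ((w 1).toNat : ℤ)] : Site 2) = w := by
      ext i; fin_cases i
      · simp [hw.1]
      · simp [Int.toNat_of_nonneg hw.2]
    rw [hw'] at hpath
    rw [stripMark_last]
    exact stripConn_trans h (mem_stripConn_iff_pathIn.2 hpath.symm)
  · intro h
    exact ⟨_, stripMark_last_mem_rightWall L, h⟩

/-- **The wall event is a function of the base state** on configurations with black walls (in
particular under `cornerFugacityStrip` and `herringboneTriStrip`): it occurs iff some base mark
`x + 1`, `x ∈ I`, `x < L`, is joined to one of the two wall feet. [folklore] -/
theorem mem_wallEvent_iff_baseState {I : Set ℕ} (hwall : ∀ z ∈ leftWall ∪ rightWall L, ω.1 z = true) :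
    ω ∈ wallEvent L I ↔ ∃ x ∈ I, ∃ hx : x < L,
      baseState L ω ⟨x + 1, by omega⟩ 0 = true ∨
        baseState L ω ⟨x + 1, by omega⟩ (Fin.last (L + 1)) = true := by
  simp only [mem_wallEvent_iff, baseState_eq_true_iff]
  refine exists_congr fun x => and_congr_right fun _ => ⟨?_, ?_⟩
  · rintro ⟨hx, w, hw, h⟩
    refine ⟨hx, ?_⟩
    rw [stripMark_succ L x hx]
    rcases hw with hw | hw
    · exact Or.inl ((stripConn_leftWall_iff_foot (fun z hz => hwall z (Or.inl hz)) _).1 ⟨w, hw, h⟩)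
    · exact Or.inr ((stripConn_rightWall_iff_foot (fun z hz => hwall z (Or.inr hz)) _).1 ⟨w, hw, h⟩)
  · rintro ⟨hx, h⟩
    refine ⟨hx, ?_⟩
    rw [stripMark_succ L x hx] at h
    rcases h with h | h
    · exact ⟨_, Or.inl (stripMark_zero_mem_leftWall L), h⟩
    · exact ⟨_, Or.inr (stripMark_last_mem_rightWall L), h⟩

end Walls

/-! ### The herringbone triangular strip (D1') -/

/-- The **herringbone coins**: NE–SW diagonals (`true`) in the faces of even rows, NW–SE (`false`)
in odd rows. The resulting triangulation of the cell grid is the triangular lattice drawn with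
alternately sheared rows (Morin-Duchesne–Klümper–Pearce 2023, §2.2: "on the cylinder, the shear is
applied in different directions for the even and odd rows"), `herringboneIso`. [cite: MorinDuchesneKlumperPearce2023, §2.2] -/
def herringboneCoin (w : Site 2) : Bool := decide (Even (w 1))

/-- The herringbone coin is `true` exactly in even rows. [folklore] -/
theorem herringboneCoin_eq_true_iff (w : Site 2) : herringboneCoin w = true ↔ Even (w 1) := by
  simp [herringboneCoin]

/-- The herringbone configuration map: cell `(x, y)` of the strip gets the fair bit `c (x, y)`,
walls black, outside white; coins deterministic herringbone. [folklore] -/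
def herringboneConfig (L : ℕ) (c : ℕ × ℕ → Bool) : CellConfig :=
  (stripColouring L (fun x y => c (x, y)), herringboneCoin)

/-- The colouring component of the herringbone configuration. [folklore] -/
@[simp] theorem herringboneConfig_fst (L : ℕ) (c : ℕ × ℕ → Bool) :
    (herringboneConfig L c).1 = stripColouring L (fun x y => c (x, y)) := rfl
/-- The coin component of the herringbone configuration. [folklore] -/
@[simp] theorem herringboneConfig_snd (L : ℕ) (c : ℕ × ℕ → Bool) :
    (herringboneConfig L c).2 = herringboneCoin := rfl

/-- The i.i.d. fair cell bits of the herringbone strip. [folklore] -/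
def fairCellMeasure : Measure (ℕ × ℕ → Bool) :=
  Measure.infinitePi fun _ : ℕ × ℕ => Ber(true, false, half)

/-- `fairCellMeasure` is a probability measure. [folklore] -/
instance instIsProbabilityMeasureFairCellMeasure : IsProbabilityMeasure fairCellMeasure := by
  unfold fairCellMeasure; infer_instance

/-- The herringbone configuration map is measurable. [folklore] -/
theorem measurable_herringboneConfig (L : ℕ) : Measurable (herringboneConfig L) := by
  refine Measurable.prodMk (measurable_pi_lambda _ fun z => ?_) measurable_const
  exact measurable_stripColouring L (fun x y => measurable_pi_apply (x, y)) z

/-- **The herringbone triangular strip** `herringboneTriStrip L` (D1'): site percolation with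
i.i.d. fair cells on the strip `{0..L-1} × ℕ`, fixed black walls `x = -1`, `x = L`, white outside,
and the deterministic herringbone diagonals — the `u = π/3` member of the Izergin–Korepin line as
drawn by Morin-Duchesne–Klümper–Pearce (2023), §2.1–2.2 (alternately sheared rows; "a fixed colour … to
all the sites belonging to the first two columns" on each boundary), i.e. site percolation on `𝕋`
at `p = 1/2` with fixed-colour boundary columns — here semi-infinite in the vertical direction. Same
walls, marks and events as `cornerFugacityStrip`. [cite: MorinDuchesneKlumperPearce2023, §2.1–2.2] -/
def herringboneTriStrip (L : ℕ) : Measure CellConfig :=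
  fairCellMeasure.map (herringboneConfig L)

/-- `herringboneTriStrip L` is a probability measure. [folklore] -/
instance instIsProbabilityMeasureHerringboneTriStrip (L : ℕ) :
    IsProbabilityMeasure (herringboneTriStrip L) :=
  Measure.isProbabilityMeasure_map (measurable_herringboneConfig L).aemeasurable

/-- Walls of the herringbone strip are black, surely. [folklore] -/
theorem herringboneConfig_wall (L : ℕ) (c : ℕ × ℕ → Bool) {z : Site 2}
    (hz : z ∈ leftWall ∪ rightWall L) : (herringboneConfig L c).1 z = true := by
  rw [herringboneConfig_fst]; exact stripColouring_of_mem_wall _ hz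

/-- The law of the base state of the herringbone strip. [folklore] -/
def herringboneBaseStateLaw (L : ℕ) : Measure (Fin (L + 2) → Fin (L + 2) → Bool) :=
  (herringboneTriStrip L).map (baseState L)

/-- The shear `(x, y) ↦ (x + ⌊y/2⌋, y)` straightening the herringbone rows. [folklore] -/
def herringboneShear : Site 2 ≃ Site 2 where
  toFun z := ![z 0 + z 1 / 2, z 1]
  invFun z := ![z 0 - z 1 / 2, z 1]
  left_inv z := by ext i; fin_cases i <;> simp
  right_inv z := by ext i; fin_cases i <;> simp

/-- First coordinate of the shear. [folklore] -/
@[simp] theorem herringboneShear_apply_zero (z : Site 2) : herringboneShear z 0 = z 0 + z 1 / 2 := rfl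
/-- Second coordinate of the shear. [folklore] -/
@[simp] theorem herringboneShear_apply_one (z : Site 2) : herringboneShear z 1 = z 1 := rfl

/-- The herringbone coin in terms of `% 2`. [folklore] -/
theorem herringboneCoin_eq_true_iff_emod (w : Site 2) : herringboneCoin w = true ↔ w 1 % 2 = 0 := by
  rw [herringboneCoin_eq_true_iff, Int.even_iff]

/-- The herringbone coin in terms of `% 2`. [folklore] -/
theorem herringboneCoin_eq_false_iff_emod (w : Site 2) : herringboneCoin w = false ↔ w 1 % 2 = 1 := by
  rw [← Bool.not_eq_true, herringboneCoin_eq_true_iff_emod]; omega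

/-- `(z - 1) % 2 = 1 ↔ z % 2 = 0`. [folklore] -/
private theorem sub_one_emod_two (z : ℤ) : (z - 1) % 2 = 1 ↔ z % 2 = 0 := by omega

/-- Adjacency of the coin-selected triangulation in coordinates. [folklore] -/
theorem cellGraph_adj_iff_coord (κ : Site 2 → Bool) (a b : Site 2) :
    (cellGraph κ).Adj a b ↔
      (((b 0 = a 0 + 1 ∨ a 0 = b 0 + 1) ∧ b 1 = a 1) ∨ ((b 1 = a 1 + 1 ∨ a 1 = b 1 + 1) ∧ b 0 = a 0)) ∨
      ((κ a = true ∧ b 0 = a 0 + 1 ∧ b 1 = a 1 + 1) ∨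
        (κ (a - Pi.single 1 1) = false ∧ b 0 = a 0 + 1 ∧ b 1 = a 1 - 1)) ∨
      ((κ b = true ∧ a 0 = b 0 + 1 ∧ a 1 = b 1 + 1) ∨
        (κ (b - Pi.single 1 1) = false ∧ a 0 = b 0 + 1 ∧ a 1 = b 1 - 1)) := by
  rw [cellGraph_adj_iff, zd2_adj_coord', cellDiagRel_iff_coord, cellDiagRel_iff_coord]

/-- Adjacency of the herringbone triangulation in coordinates: axis neighbours, and the diagonal
neighbours `(x+1, y±1)` of a cell in an even row, `(x-1, y±1)` in an odd row. [folklore] -/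
theorem cellGraph_herringbone_adj_iff (a b : Site 2) :
    (cellGraph herringboneCoin).Adj a b ↔
      (((b 0 = a 0 + 1 ∨ a 0 = b 0 + 1) ∧ b 1 = a 1) ∨ ((b 1 = a 1 + 1 ∨ a 1 = b 1 + 1) ∧ b 0 = a 0)) ∨
      ((a 1 % 2 = 0 ∧ b 0 = a 0 + 1 ∧ b 1 = a 1 + 1) ∨ (a 1 % 2 = 0 ∧ b 0 = a 0 + 1 ∧ b 1 = a 1 - 1)) ∨
      ((b 1 % 2 = 0 ∧ a 0 = b 0 + 1 ∧ a 1 = b 1 + 1) ∨ (b 1 % 2 = 0 ∧ a 0 = b 0 + 1 ∧ a 1 = b 1 - 1)) := by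
  rw [cellGraph_adj_iff_coord]
  simp only [herringboneCoin_eq_true_iff_emod, herringboneCoin_eq_false_iff_emod, Pi.sub_apply,
    Pi.single_eq_same, sub_one_emod_two]

/-- Adjacency of the NE–SW triangulation in coordinates. [folklore] -/
theorem cellGraph_true_adj_iff (a b : Site 2) :
    (cellGraph fun _ : Site 2 => true).Adj a b ↔
      (((b 0 = a 0 + 1 ∨ a 0 = b 0 + 1) ∧ b 1 = a 1) ∨ ((b 1 = a 1 + 1 ∨ a 1 = b 1 + 1) ∧ b 0 = a 0)) ∨
      (b 0 = a 0 + 1 ∧ b 1 = a 1 + 1) ∨ (a 0 = b 0 + 1 ∧ a 1 = b 1 + 1) := by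
  rw [cellGraph_adj_iff_coord]
  simp only [Bool.true_eq_false, false_and, or_false, true_and]

/-- **Dictionary.** The herringbone triangulation is isomorphic, by the row shear
`(x, y) ↦ (x + ⌊y/2⌋, y)`, to the NE–SW triangulation `cellGraph (fun _ => true)` (itself
`≃g triGraph` by `cellGraphTrueIso`): the herringbone strip is site percolation on the triangular
lattice. (Morin-Duchesne–Klümper–Pearce 2023, §2.2: "rows sheared alternately".) [cite: MorinDuchesneKlumperPearce2023, §2.2] -/
def herringboneIso : cellGraph herringboneCoin ≃g cellGraph (fun _ : Site 2 => true) where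
  toEquiv := herringboneShear
  map_rel_iff' := by
    intro a b
    change (cellGraph fun _ => true).Adj (herringboneShear a) (herringboneShear b) ↔
      (cellGraph herringboneCoin).Adj a b
    rw [cellGraph_true_adj_iff, cellGraph_herringbone_adj_iff]
    simp only [herringboneShear_apply_zero, herringboneShear_apply_one]
    -- eliminate `/ 2`, `% 2` by hand (omega's case splitting is too slow on the raw goal)
    rcases Int.even_or_odd' (a 1) with ⟨k, hk | hk⟩ <;>
    rcases Int.even_or_odd' (b 1) with ⟨m, hm | hm⟩ <;>
    · have h1 : a 1 / 2 = k := by omega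
      have h2 : b 1 / 2 = m := by omega
      obtain ⟨r, hr, hr'⟩ : ∃ r, a 1 % 2 = r ∧ (r = 0 ∨ r = 1) :=
        ⟨_, rfl, Int.emod_two_eq_zero_or_one _⟩
      obtain ⟨s, hs, hs'⟩ : ∃ s, b 1 % 2 = s ∧ (s = 0 ∨ s = 1) :=
        ⟨_, rfl, Int.emod_two_eq_zero_or_one _⟩
      rw [h1, h2, hr, hs]
      have hr2 : r = a 1 - 2 * k := by omega
      have hs2 : s = b 1 - 2 * m := by omega
      subst hr2 hs2
      clear hr hs hr' hs' h1 h2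
      constructor
      · rintro (((h | h) | (h | h)) | h | h) <;> omega
      · rintro (((h | h) | (h | h)) | (h | h) | (h | h)) <;> omega


/-! ### The plaquette Gibbs identification (finite-box probabilities) -/

section Gibbs

variable {L N : ℕ}

/-- The **plaquette parity** of a strip pattern `s` at the grid vertex `(x, y)`: `true` iff an odd
number of the four cells `(x,y), (x+1,y), (x,y+1), (x+1,y+1)` is black. (Card
`corner-fugacity-plane`: corner fugacity `t` per odd vertex.) [folklore] -/
def plaquetteOdd (s : ℕ → ℕ → Bool) (x y : ℕ) : Bool :=
  ((s x y ^^ s (x + 1) y) ^^ (s x (y + 1) ^^ s (x + 1) (y + 1)))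

/-- The number of odd plaquettes of the pattern `s` **inside** the box `{0..L-1} × {0..N}`: grid
vertices `(x, y)` with `x < L - 1`, `y < N` (no plaquette weight at the walls, the base or the
top). [folklore] -/
def oddPlaquetteCount (L N : ℕ) (s : ℕ → ℕ → Bool) : ℕ :=
  ((Finset.range (L - 1) ×ˢ Finset.range N).filter fun p => plaquetteOdd s p.1 p.2 = true).card

/-- **The box cylinder**: the colouring agrees with the pattern `s` on the box `{0..L-1} × {0..N}`
of strip cells. [folklore] -/
def boxCylinder (L N : ℕ) (s : ℕ → ℕ → Bool) : Set CellConfig :=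
  {ω | ∀ x < L, ∀ y ≤ N, ω.1 ![(x : ℤ), (y : ℤ)] = s x y}

/-- Membership in the box cylinder, unfolded. [folklore] -/
theorem mem_boxCylinder_iff {s : ℕ → ℕ → Bool} {ω : CellConfig} :
    ω ∈ boxCylinder L N s ↔ ∀ x < L, ∀ y ≤ N, ω.1 ![(x : ℤ), (y : ℤ)] = s x y := Iff.rfl

/-- Box cylinders are measurable (finite intersections of one-cell cylinders). [folklore] -/
theorem measurableSet_boxCylinder (L N : ℕ) (s : ℕ → ℕ → Bool) :
    MeasurableSet (boxCylinder L N s) := by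
  have hset : boxCylinder L N s = ⋂ x ∈ Set.Iio L, ⋂ y ∈ Set.Iic N,
      {ω : CellConfig | ω.1 ![(x : ℤ), (y : ℤ)] = s x y} := by
    ext ω; simp only [mem_boxCylinder_iff, Set.mem_iInter, Set.mem_Iio, Set.mem_Iic, Set.mem_setOf_eq]
  rw [hset]
  exact MeasurableSet.biInter (Set.to_countable _) fun x _ =>
    MeasurableSet.biInter (Set.to_countable _) fun y _ => measurableSet_colour_eq _ _

/-- The bits read off a box pattern `s`: `A_y = s(0,y)`, `a_x = s(x,0) ⊕ s(x+1,0)`,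
`ξ_{x,y} =` plaquette parity of `s` at `(x, y)` (coins are not read). [folklore] -/
def boxBitValue (s : ℕ → ℕ → Bool) : StripBit → Bool
  | .row y => s 0 y
  | .line x => (s x 0 ^^ s (x + 1) 0)
  | .flip x y => plaquetteOdd s x y
  | .coin _ => false

/-- The finitely many bits that determine the colouring of the box `{0..L-1} × {0..N}`: the row
seeds `A_0..A_N`, the line seeds `a_0..a_{L-2}` and the flips `ξ_{x,y}`, `x < L-1`, `y < N`.
[folklore] -/
def boxBits (L N : ℕ) : Finset StripBit :=
  (Finset.range (N + 1)).image StripBit.row ∪ (Finset.range (L - 1)).image StripBit.line ∪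
    (Finset.range (L - 1) ×ˢ Finset.range N).image fun p => StripBit.flip p.1 p.2

/-- The preimage of a box cylinder under the configuration map is the set of bit configurations
whose spins match the pattern on the box. [folklore] -/
theorem stripConfig_preimage_boxCylinder (L N : ℕ) (s : ℕ → ℕ → Bool) :
    stripConfig L ⁻¹' boxCylinder L N s = {β | ∀ x < L, ∀ y ≤ N, stripSpin β x y = s x y} := by
  ext β
  simp only [Set.mem_preimage, mem_boxCylinder_iff, Set.mem_setOf_eq]
  refine forall₂_congr fun x hx => forall₂_congr fun y _ => ?_
  rw [stripConfig_natCell L β hx]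

/-- **The XOR change of variables is a bijection on boxes.** The spins match the pattern `s` on the
box `{0..L-1} × {0..N}` iff the bits `A_y (y ≤ N)`, `a_x (x < L-1)`, `ξ_{x,y} (x < L-1, y < N)`
take the values read off `s` — a one-point cylinder of the product measure. [folklore] -/
theorem setOf_stripSpin_eq_eq_pi (hL : 0 < L) (s : ℕ → ℕ → Bool) :
    {β : StripBit → Bool | ∀ x < L, ∀ y ≤ N, stripSpin β x y = s x y} =
      Set.pi ↑(boxBits L N) fun i => {boxBitValue s i} := by
  ext β
  simp only [Set.mem_setOf_eq, Set.mem_pi, Finset.mem_coe, Set.mem_singleton_iff, boxBits,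
    Finset.mem_union, Finset.mem_image, Finset.mem_range, Finset.mem_product]
  constructor
  · intro h i hi
    rcases hi with (⟨y, hy, rfl⟩ | ⟨x, hx, rfl⟩) | ⟨⟨x, y⟩, ⟨hx, hy⟩, rfl⟩
    · change β (.row y) = s 0 y
      rw [← stripSpin_zero β y, h 0 hL y (by omega)]
    · change β (.line x) = (s x 0 ^^ s (x + 1) 0)
      rw [show β (.line x) = lineChain β x 0 from rfl, lineChain_eq_xor_stripSpin,
        h x (by omega) 0 (Nat.zero_le _), h (x + 1) (by omega) 0 (Nat.zero_le _)]
    · change β (.flip x y) = plaquetteOdd s x y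
      rw [← stripSpin_plaquette β x y, plaquetteOdd, h x (by omega) y (by omega),
        h (x + 1) (by omega) y (by omega), h x (by omega) (y + 1) (by omega),
        h (x + 1) (by omega) (y + 1) (by omega)]
  · intro h
    have hrow : ∀ y ≤ N, β (.row y) = s 0 y := fun y hy => h _ (Or.inl (Or.inl ⟨y, by omega, rfl⟩))
    have hline : ∀ x, x + 1 < L → β (.line x) = (s x 0 ^^ s (x + 1) 0) := fun x hx =>
      h _ (Or.inl (Or.inr ⟨x, by omega, rfl⟩))
    have hflip : ∀ x, x + 1 < L → ∀ y < N, β (.flip x y) = plaquetteOdd s x y := fun x hx y hy =>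
      h _ (Or.inr ⟨(x, y), ⟨by omega, hy⟩, rfl⟩)
    have hchain : ∀ x, x + 1 < L → ∀ y ≤ N, lineChain β x y = (s x y ^^ s (x + 1) y) := by
      intro x hx y
      induction y with
      | zero => intro; rw [lineChain_zero, hline x hx]
      | succ y ih =>
        intro hy
        rw [lineChain_succ, ih (by omega), hflip x hx y (by omega), plaquetteOdd]
        cases s x y <;> cases s (x + 1) y <;> cases s x (y + 1) <;> cases s (x + 1) (y + 1) <;> rfl
    intro x
    induction x with
    | zero => intro _ y hy; rw [stripSpin_zero, hrow y hy]
    | succ x ih =>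
      intro hx y hy
      rw [stripSpin_succ, ih (by omega) y hy, hchain x hx y hy]
      cases s x y <;> cases s (x + 1) y <;> rfl

/-- The one-bit laws on singletons, as real numbers: fair bits give `1/2`, flips give
`t/(1+t)` or `1/(1+t)`. [folklore] -/
theorem bernoulli_real_singleton (p : unitInterval) (c : Bool) :
    (Ber(true, false, p)).real {c} = if c then (p : ℝ) else 1 - p := by
  cases c
  · rw [bernoulliMeasure_real_apply_of_notMem_of_mem p (measurableSet_singleton _) (by simp) rfl]
    simp
  · rw [bernoulliMeasure_real_apply_of_mem_of_notMem p (measurableSet_singleton _) rfl (by simp)]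
    simp

/-- **Free-boundary plaquette Gibbs measure on boxes (the partition function factorises over the
column lines).** For `t ≥ 0`, `0 < L` and every height `N`, the probability under
`cornerFugacityStrip t b L` that the colouring of the box `{0..L-1} × {0..N}` equals a given
pattern `s` is

  `t ^ #{odd plaquettes of s inside the box} / (2 ^ (N + L) * (1 + t) ^ (N * (L - 1)))`,

i.e. the Boltzmann weight `∏_{plaquettes inside the box} t^[odd]` normalised by
`Z_{L,N}(t) = 2^(N+L) (1+t)^(N(L-1)) = 2^(N+1) · (2 (1+t)^N)^(L-1)` (one free two-state chain of
length `N` per column line): the colouring marginal of the strip law is the free-boundary Gibbs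
measure of the 4-spin plaquette weight, consistently in `N`. (Card `corner-fugacity-plane`: "the
colouring marginal is the exactly solvable 4-spin plaquette field (independent column flip-chains,
flip probability `t/(1+t)`)"; route `CardyCornerFugacity` D1, the claim to be verified by the
definer.) [folklore] -/
theorem cornerFugacityStrip_real_boxCylinder {t : ℝ} (ht : 0 ≤ t) (b : unitInterval) (hL : 0 < L)
    (N : ℕ) (s : ℕ → ℕ → Bool) :
    (cornerFugacityStrip t b L).real (boxCylinder L N s) =
      t ^ oddPlaquetteCount L N s / (2 ^ (N + L) * (1 + t) ^ (N * (L - 1))) := by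
  have h1t : (1 : ℝ) + t ≠ 0 := by positivity
  rw [measureReal_def, cornerFugacityStrip_apply t b L (measurableSet_boxCylinder L N s),
    stripConfig_preimage_boxCylinder, setOf_stripSpin_eq_eq_pi hL, stripBitMeasure,
    Measure.infinitePi_pi _ (fun i _ => measurableSet_singleton _), ENNReal.toReal_prod]
  simp_rw [← measureReal_def]
  -- split the product over rows, lines and flips
  have hdisj₁ : Disjoint ((Finset.range (N + 1)).image StripBit.row)
      ((Finset.range (L - 1)).image StripBit.line) := by
    rw [Finset.disjoint_left]
    rintro i hi hi'
    obtain ⟨y, -, rfl⟩ := Finset.mem_image.1 hi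
    obtain ⟨x, -, h⟩ := Finset.mem_image.1 hi'
    cases h
  have hdisj₂ : Disjoint ((Finset.range (N + 1)).image StripBit.row ∪
      (Finset.range (L - 1)).image StripBit.line)
      ((Finset.range (L - 1) ×ˢ Finset.range N).image fun p => StripBit.flip p.1 p.2) := by
    rw [Finset.disjoint_left]
    rintro i hi hi'
    obtain ⟨p, -, rfl⟩ := Finset.mem_image.1 hi'
    rcases Finset.mem_union.1 hi with hi | hi
    · obtain ⟨y, -, h⟩ := Finset.mem_image.1 hi; cases h
    · obtain ⟨x, -, h⟩ := Finset.mem_image.1 hi; cases h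
  rw [boxBits, Finset.prod_union hdisj₂, Finset.prod_union hdisj₁,
    Finset.prod_image (fun a _ b _ h => by injection h),
    Finset.prod_image (fun a _ b _ h => by injection h),
    Finset.prod_image (by rintro ⟨a, b⟩ _ ⟨c, d⟩ _ h; simp only [StripBit.flip.injEq] at h; rw [h.1, h.2])]
  -- evaluate the three products
  have hrow : ∏ y ∈ Finset.range (N + 1), (stripBitLaw t b (.row y)).real {boxBitValue s (.row y)} =
      (1 / 2) ^ (N + 1) := by
    rw [Finset.prod_eq_pow_card (b := 1 / 2), Finset.card_range]
    intro y _
    rw [stripBitLaw, bernoulli_real_singleton, coe_half]; split_ifs <;> norm_num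
  have hline : ∏ x ∈ Finset.range (L - 1), (stripBitLaw t b (.line x)).real {boxBitValue s (.line x)} =
      (1 / 2) ^ (L - 1) := by
    rw [Finset.prod_eq_pow_card (b := 1 / 2), Finset.card_range]
    intro x _
    rw [stripBitLaw, bernoulli_real_singleton, coe_half]; split_ifs <;> norm_num
  have hflip : ∏ p ∈ Finset.range (L - 1) ×ˢ Finset.range N,
      (stripBitLaw t b (.flip p.1 p.2)).real {boxBitValue s (.flip p.1 p.2)} =
      t ^ oddPlaquetteCount L N s / (1 + t) ^ (N * (L - 1)) := by
    have hfac : ∀ p : ℕ × ℕ, (stripBitLaw t b (.flip p.1 p.2)).real {boxBitValue s (.flip p.1 p.2)} =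
        (if plaquetteOdd s p.1 p.2 = true then t else 1) / (1 + t) := by
      intro p
      rw [stripBitLaw, bernoulli_real_singleton, coe_flipProb ht]
      change (if plaquetteOdd s p.1 p.2 = true then t / (1 + t) else 1 - t / (1 + t)) = _
      split_ifs
      · rfl
      · field_simp; ring
    simp_rw [hfac]
    rw [Finset.prod_div_distrib, Finset.prod_const, Finset.card_product, Finset.card_range,
      Finset.card_range, Finset.prod_ite, Finset.prod_const, Finset.prod_const_one, mul_one,
      oddPlaquetteCount, mul_comm N]
  rw [hrow, hline, hflip]
  have hexp : N + 1 + (L - 1) = N + L := by omega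
  rw [← pow_add, hexp, one_div, inv_pow]
  field_simp

/-- The number of odd plaquettes inside the box is invariant under the reflection
`x ↦ L - 1 - x` of the strip (which maps the vertex column `x` to `L - 2 - x`). [folklore] -/
theorem oddPlaquetteCount_reflect (hL : 0 < L) (N : ℕ) (s : ℕ → ℕ → Bool) :
    oddPlaquetteCount L N (fun x y => s (L - 1 - x) y) = oddPlaquetteCount L N s := by
  unfold oddPlaquetteCount
  -- the reflection `x ↦ L - 2 - x` of the vertex columns is an involution of `range (L-1)`
  refine Finset.card_bij (fun p _ => (L - 2 - p.1, p.2)) ?_ ?_ ?_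
  · rintro ⟨x, y⟩ hp
    simp only [Finset.mem_filter, Finset.mem_product, Finset.mem_range] at hp ⊢
    refine ⟨⟨by omega, hp.1.2⟩, ?_⟩
    have hx1 : L - 1 - x = L - 2 - x + 1 := by omega
    have hx2 : L - 1 - (x + 1) = L - 2 - x := by omega
    rw [← hp.2, plaquetteOdd, plaquetteOdd, hx1, hx2]
    cases s (L - 2 - x) y <;> cases s (L - 2 - x + 1) y <;> cases s (L - 2 - x) (y + 1) <;>
      cases s (L - 2 - x + 1) (y + 1) <;> rfl
  · rintro ⟨x, y⟩ hp ⟨x', y'⟩ hp' h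
    simp only [Finset.mem_filter, Finset.mem_product, Finset.mem_range, Prod.mk.injEq] at hp hp' h ⊢
    omega
  · rintro ⟨x, y⟩ hp
    simp only [Finset.mem_filter, Finset.mem_product, Finset.mem_range, exists_prop] at hp ⊢
    refine ⟨(L - 2 - x, y), ⟨⟨by omega, hp.1.2⟩, ?_⟩, ?_⟩
    swap
    · change (L - 2 - (L - 2 - x), y) = (x, y)
      rw [show L - 2 - (L - 2 - x) = x by omega]
    have hx1 : L - 1 - (L - 2 - x) = x + 1 := by omega
    have hx2 : L - 1 - (L - 2 - x + 1) = x := by omega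
    rw [← hp.2, plaquetteOdd, plaquetteOdd, hx1, hx2]
    cases s x y <;> cases s (x + 1) y <;> cases s x (y + 1) <;> cases s (x + 1) (y + 1) <;> rfl

/-- **Reflection symmetry of the colouring law on boxes.** The probability of a box pattern equals
that of its mirror image under `x ↦ L - 1 - x`: the plaquette weight is reflection invariant and
so is the normalisation. Box cylinders of all heights `N` determine the law of the colouring of
the strip, so this is the reflection invariance `x ↔ L-1-x` of the colouring marginal asked for in
route `CardyCornerFugacity` D1 (the coins, `Ber(b)` i.i.d., are reflection invariant as a field,
while the reflection exchanges NE–SW and NW–SE pairs, i.e. `b ↔ 1 - b`, an exact symmetry only at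
`b = 1/2`; the measure-level identity on `CellConfig` is not spelled out here). (Card
`corner-fugacity-plane`: `D₄` symmetry and self-duality of `M(t, 1/2)`.) [folklore] -/
theorem cornerFugacityStrip_real_boxCylinder_reflect {t : ℝ} (ht : 0 ≤ t) (b : unitInterval)
    (hL : 0 < L) (N : ℕ) (s : ℕ → ℕ → Bool) :
    (cornerFugacityStrip t b L).real (boxCylinder L N fun x y => s (L - 1 - x) y) =
      (cornerFugacityStrip t b L).real (boxCylinder L N s) := by
  rw [cornerFugacityStrip_real_boxCylinder ht b hL, cornerFugacityStrip_real_boxCylinder ht b hL,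
    oddPlaquetteCount_reflect hL]

/-- **`t = 1`: i.i.d. fair cells on boxes.** At `t = 1` every pattern of the box
`{0..L-1} × {0..N}` has probability `2 ^ (-(N + 1) L)`. [folklore] -/
theorem cornerFugacityStrip_one_real_boxCylinder (b : unitInterval) (hL : 0 < L) (N : ℕ)
    (s : ℕ → ℕ → Bool) :
    (cornerFugacityStrip 1 b L).real (boxCylinder L N s) = 1 / 2 ^ ((N + 1) * L) := by
  rw [cornerFugacityStrip_real_boxCylinder zero_le_one b hL, one_pow]
  have h : (N + 1) * L = N + L + N * (L - 1) := by
    obtain ⟨L', rfl⟩ : ∃ L', L = L' + 1 := ⟨L - 1, by omega⟩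
    simp only [Nat.add_sub_cancel]; ring
  have h2 : (2 : ℝ) ^ ((N + 1) * L) = 2 ^ (N + L) * 2 ^ (N * (L - 1)) := by rw [h, pow_add]
  rw [h2]; norm_num

/-- **`t = 0`: XOR colourings on boxes.** At the frozen point a box pattern has positive
probability only if it has no odd plaquette, and then probability `1 / 2 ^ (N + L)` (the
`2^(N+L)` XOR patterns `σ(x,y) = A_y ⊕ a_0 ⊕ ⋯ ⊕ a_{x-1}` are equally likely). [folklore] -/
theorem cornerFugacityStrip_zero_real_boxCylinder (b : unitInterval) (hL : 0 < L) (N : ℕ)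
    (s : ℕ → ℕ → Bool) :
    (cornerFugacityStrip 0 b L).real (boxCylinder L N s) =
      if oddPlaquetteCount L N s = 0 then 1 / 2 ^ (N + L) else 0 := by
  rw [cornerFugacityStrip_real_boxCylinder le_rfl b hL]
  split_ifs with h
  · rw [h]; norm_num
  · rw [zero_pow h]; simp

end Gibbs

end

end Literature.Probability.LatticeModels
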